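import Literature.NumberTheory.EllipticCurves.FunctionFieldSelmerInertia
import Literature.NumberTheory.EllipticCurves.FunctionFieldGoodReductionInertia
import Literature.NumberTheory.EllipticCurves.KummerGeneratorNormal
import Literature.NumberTheory.EllipticCurves.KummerUnramifiedDedekind
import Literature.NumberTheory.EllipticCurves.SelmerInertiaProofs
import Literature.NumberTheory.GaloisRepresentations.AbsGaloisGroupCompact
import Mathlib.FieldTheory.SeparableClosure
import HarnessLib

/-!
# Local inertia surjects onto global inertia at a place of a field (Neukirch, ANT II (9.6)),
# in every characteristic

Eighth decomposition file (D-0014/D-0026, provefact seat on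
`Literature.NumberTheory.EllipticCurves.FunctionField.finite_shaPrimeToChar_torsionBy`, statement
file `FunctionField`, bsd.S33). The glue `FunctionFieldSelmerInertia.selmerGroup_le_h1Unramified_of_local`
needs, at every place `v` (a discrete valuation ring `O_v ⊆ F`, completion `F_v`, files
`FunctionFieldPlaces`/`FunctionFieldSelmerInertia`), the **local–global compatibility of inertia
groups (LG)**: for an `F`-embedding `ι : F̄ → F̄_v`, a prime `𝔐` of the local absolute integers
`\bar O_{F_v}` above `𝔪_{F_v}` and `τ` in the inertia group `I_𝔓 ≤ Γ_F` of the prime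
`𝔓 = 𝔓_{ι,𝔐}` of `\bar O_v` cut out by `ι` (`Place.primeBelow`), there is `σ` in the local
inertia group `I_𝔐 ≤ Γ_{F_v}` with `ι ∘ τ = σ ∘ ι`. This is Neukirch, *Algebraic Number Theory*,
Ch. II §9, Prop. (9.6) (`G_w(L|K) ≅ G(L_w|K_v)`, `I_w(L|K) ≅ I(L_w|K_v)`, with (9.9)) for `L = F̄`,
and the tree proves it for the finite places of a number field in `SelmerInertiaProofs`
(`exists_mem_inertia_apply_eq_holds'`). This file proves it for **a place of an arbitrary field**
(`Place.exists_mem_inertia_apply_eq`), following the tree file step by step (§A–§F), with three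
changes forced by positive characteristic:

* §B–§C (the prime of `F(x)` below `v` cut out by `ι`; isometry; fractions): the tree works in the
  Dedekind domain `𝓞_{K(x)}`; here `F(x)/F` may be inseparable, and the integral closure of `O_v`
  is taken in the **separable closure** `F(x)_s` of `F` in `F(x)` (finite separable, so the
  integral closure is Dedekind, Mathlib), the passage to `x` being by a `q`-power
  `x^{q^e} ∈ F(x)_s` (`x ↦ x^{q^e}` preserves absolute values up to the exponent, and
  `(x s)^{q^e} ∈ \bar O_v` forces `x s ∈ \bar O_v`, the integral closure being integrally closed);
* §E (correction into the local inertia group): the invariants of `N = Aut(F̄_v / F_v(ι α))` in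
  `F̄_v` form the *perfect closure* of `F_v(ι α)` (`mem_perfectClosure_of_forall_algEquiv_apply_eq_of_isAlgClosed`,
  `KummerUnramifiedDedekind`), not the field itself; an `N`-invariant local absolute integer `b`
  has a `q`-power in `F_v(ι α)`, to which the density estimate applies, and
  `‖σ₀ b - b‖^{q^m} = ‖σ₀ b^{q^m} - b^{q^m}‖ < 1`;
* §F (the limit over finite normal subextensions): a finite normal `E ⊆ F̄` need not be simple; its
  separable part `E ∩ F^{sep}` is finite, separable (hence simple, primitive element theorem) and
  normal (`IntermediateField.normal_inf`, the separable closure being Galois), and has the same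
  fixing group (`mem_fixingSubgroup_of_mem_fixingSubgroup_inf_separableClosure`,
  `KummerGeneratorNormal`).

Everything else is the tree's argument verbatim: §A the absolute value `‖ι ·‖_v` on `F̄` (spectral
norm of `F̄_v/F_v`, for the rank-one structure of `FunctionFieldGoodReductionInertia`); §D extension
by continuity (`F` is dense in `F_v`, Mathlib `denseRange_algebraMap`,
`Polynomial.exists_monic_and_natDegree_eq_and_norm_map_algebraMap_coeff_sub_lt`); §F compactness of
`I_𝔐` (closed in the compact `Γ_{F_v}`, `absoluteGaloisGroup_compactSpace` in every characteristic)
and continuity of restriction (`resGalOfEmb`).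

## References

* [NeukirchANT1999] J. Neukirch, *Algebraic Number Theory*, Springer 1999, Ch. II §3 (3.3)–(3.4),
  (3.8), §4 (4.8), §8 (8.1)–(8.2), §9 (9.3), Prop. (9.6) with its proof, (9.9).
* [SerreLocalFields1979] J.-P. Serre, *Local Fields*, Ch. I §7 Prop. 22(b) (through `InertiaLift`).
* [SilvermanAEC2009] J. H. Silverman, *The Arithmetic of Elliptic Curves*, 2nd ed., X.§4 (the
  identification `G_v ⊂ G_{K̄/K}` served by the statement).
-/

noncomputable section

open scoped Classical NNReal Valued Pointwise WithZero IntermediateField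

namespace Literature.NumberTheory.EllipticCurves.FunctionField

open Literature.NumberTheory.EllipticCurves Literature.NumberTheory.GaloisRepresentations Field
  IsDedekindDomain _root_.Polynomial IntermediateField

attribute [local instance] Place.rankOneValuedCompletion

variable {F : Type} [Field F] (v : Place F)

local notation "Fᵥ" => Place.Completion v
local notation "Ω" => AlgebraicClosure (Place.Completion v)
local notation "sN" => spectralNorm (Place.Completion v) (AlgebraicClosure (Place.Completion v))

/-! ## §A. The absolute value on `F̄` induced by an embedding into `F̄_v` -/

/-- The absolute value `x ↦ ‖φ x‖` on `F̄` induced by an `F`-embedding `φ : F̄ → F̄_v` and the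
spectral norm of `F̄_v / F_v` (Neukirch's extension `w = \bar v ∘ φ` of `v` to `F̄`, *ANT*, Ch. II
(8.1)). [cite: NeukirchANT1999, Ch. II (8.1)] -/
def embAbv (φ : AlgebraicClosure F →ₐ[F] Ω) : AbsoluteValue (AlgebraicClosure F) ℝ :=
  letI : NormedField Ω := spectralNorm.normedField Fᵥ Ω
  { toFun := fun x ↦ ‖φ x‖
    map_mul' := fun x y ↦ by simp only [map_mul, norm_mul]
    nonneg' := fun x ↦ norm_nonneg _
    eq_zero' := fun x ↦ by rw [norm_eq_zero, map_eq_zero_iff φ φ.injective]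
    add_le' := fun x y ↦ by simp only [map_add]; exact norm_add_le _ _ }

variable {v}

/-- Unfolding `embAbv`: `embAbv v φ x = spectralNorm F_v F̄_v (φ x)`. [folklore] -/
theorem embAbv_apply (φ : AlgebraicClosure F →ₐ[F] Ω) (x : AlgebraicClosure F) :
    embAbv v φ x = sN (φ x) :=
  rfl

/-- `embAbv v φ` is nonarchimedean (the spectral norm is). [cite: NeukirchANT1999, Ch. II (4.8)] -/
theorem isNonarchimedean_embAbv (φ : AlgebraicClosure F →ₐ[F] Ω) :
    IsNonarchimedean (embAbv v φ) := by
  intro x y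
  rw [embAbv_apply, embAbv_apply, embAbv_apply, map_add]
  exact isNonarchimedean_spectralNorm _ _

/-- A `F`-embedding `F̄ → F̄_v` is the structure map on `F`. [folklore] -/
theorem algebraMap_algebraicClosure_eq (φ : AlgebraicClosure F →ₐ[F] Ω) (k : F) :
    φ (algebraMap F (AlgebraicClosure F) k) = algebraMap Fᵥ Ω (algebraMap F Fᵥ k) := by
  rw [φ.commutes, IsScalarTower.algebraMap_apply F Fᵥ Ω]

/-- `embAbv v φ` extends the `v`-adic absolute value of `F ⊆ F_v` (`spectralNorm_extends`).
[cite: NeukirchANT1999, Ch. II (4.8)] -/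
theorem embAbv_algebraMap (φ : AlgebraicClosure F →ₐ[F] Ω) (k : F) :
    embAbv v φ (algebraMap F (AlgebraicClosure F) k) = ‖algebraMap F Fᵥ k‖ := by
  rw [embAbv_apply, algebraMap_algebraicClosure_eq, spectralNorm_extends]

/-- Elements of `𝔪_v ⊆ O_v` have `embAbv`-value `< 1`. [folklore] -/
theorem embAbv_algebraMap_lt_one (φ : AlgebraicClosure F →ₐ[F] Ω) {π : v.1}
    (hπ : π ∈ (v.spectrum).asIdeal) :
    embAbv v φ (algebraMap v.1 (AlgebraicClosure F) π) < 1 := by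
  rw [IsScalarTower.algebraMap_apply v.1 F (AlgebraicClosure F), embAbv_algebraMap,
    Valued.toNormedField.norm_lt_one_iff]
  change Valued.v ((algebraMap v.1 F π : F) : Fᵥ) < 1
  rw [HeightOneSpectrum.valuedAdicCompletion_eq_valuation']
  exact (HeightOneSpectrum.valuation_lt_one_iff_mem _ _).mpr hπ

/-- Absolute integers (elements of `\bar O_v`) have `embAbv`-value `≤ 1`: `φ` maps `\bar O_v` into
the local absolute integers `{‖b‖ ≤ 1}`. [cite: NeukirchANT1999, Ch. II (4.8)] -/
theorem embAbv_le_one_of_mem_absIntegers (φ : AlgebraicClosure F →ₐ[F] Ω)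
    {b : AlgebraicClosure F} (hb : b ∈ absIntegers v.1 F) : embAbv v φ b ≤ 1 := by
  rw [embAbv_apply, ← Place.mem_absIntegers_completion_iff]
  exact (mem_integralClosure_iff _ _).mpr (Place.isIntegral_apply_of_mem_absIntegers v φ hb)

/-- `\bar O_v` is stable under `Γ_F`. [folklore] -/
theorem smul_mem_absIntegers (τ : absoluteGaloisGroup F) {b : AlgebraicClosure F}
    (hb : b ∈ absIntegers v.1 F) : τ • b ∈ absIntegers v.1 F :=
  (τ • (⟨b, hb⟩ : absIntegers v.1 F)).2

/-! ## §B. The separable closure of `F` in `F(x)` and the prime of its integers below `v` -/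

section SeparablePart

variable (x : AlgebraicClosure F)

/-- The separable part `F(x) ∩ F^{sep}` of `F(x) ⊆ F̄`. [folklore] -/
abbrev sepPart : IntermediateField F (AlgebraicClosure F) :=
  F⟮x⟯ ⊓ separableClosure F (AlgebraicClosure F)

/-- `F(x) ∩ F^{sep}` is finite over `F`. [folklore] -/
theorem finiteDimensional_sepPart : FiniteDimensional F (sepPart x) := by
  haveI : FiniteDimensional F F⟮x⟯ :=
    IntermediateField.adjoin.finiteDimensional (Algebra.IsIntegral.isIntegral x)
  exact Module.Finite.of_injective
    (IntermediateField.inclusion (inf_le_left : sepPart x ≤ F⟮x⟯)).toLinearMap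
    (IntermediateField.inclusion_injective (inf_le_left : sepPart x ≤ F⟮x⟯))

/-- `F(x) ∩ F^{sep}` is separable over `F`. [folklore] -/
theorem isSeparable_sepPart : Algebra.IsSeparable F (sepPart x) :=
  (le_separableClosure_iff F (AlgebraicClosure F) _).mp inf_le_right

/-- Some `q`-power of `x` lies in `F(x) ∩ F^{sep}` (`F(x)` is purely inseparable over its
separable closure). [folklore] -/
theorem exists_pow_mem_sepPart :
    ∃ e : ℕ, x ^ (ringExpChar F) ^ e ∈ sepPart x := by
  let E : IntermediateField F (AlgebraicClosure F) := F⟮x⟯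
  haveI : Algebra.IsAlgebraic F E :=
    Algebra.IsAlgebraic.of_injective E.val E.val.toRingHom.injective
  obtain ⟨n, y, hy⟩ := (isPurelyInseparable_iff_pow_mem (separableClosure F E) (ringExpChar F)).mp
    inferInstance (⟨x, IntermediateField.mem_adjoin_simple_self F x⟩ : E)
  refine ⟨n, IntermediateField.mem_inf.mpr ⟨pow_mem (IntermediateField.mem_adjoin_simple_self F x) _, ?_⟩⟩
  rw [mem_separableClosure_iff]
  have h1 : IsSeparable F (y : E) := mem_separableClosure_iff.mp y.2
  have hxq : x ^ (ringExpChar F) ^ n = ((y : E) : AlgebraicClosure F) := by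
    have := congrArg (fun z : E => (z : AlgebraicClosure F)) hy
    simpa using this.symm
  rw [hxq]
  exact (isSeparable_map_iff E.val E.val.toRingHom.injective).mpr h1

end SeparablePart

/-- **Isometry and fractions, at the separable level.** For an `F`-embedding `φ : F̄ → F̄_v`, an
element `τ ∈ Γ_F` preserving the condition `‖φ b‖ < 1` on `\bar O_v` (i.e. `τ 𝔓_{φ,𝔐} = 𝔓_{φ,𝔐}`),
and `x ∈ F̄`: on the finite separable `M = F(x) ∩ F^{sep}` the absolute values `‖φ ·‖` and
`‖φ (τ ·)‖` coincide, and every element of `M` of `‖φ ·‖`-norm `≤ 1` is a fraction `a/s` of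
elements of the integral closure `R` of `O_v` in `M` (a Dedekind domain) with `‖φ s‖ = 1`: both
absolute values are `≤ 1` on `R ⊆ \bar O_v`, cut out the same prime `𝔭 = {‖φ ·‖ < 1} ∩ R`
(nonzero: it contains a uniformiser of `v`) and agree on `F` (`absoluteValue_eq_of_prime_eq`,
`exists_mul_eq_of_absoluteValue_le_one`, tree §0–§B). Neukirch, *ANT*, Ch. II §9, proof of
Prop. (9.6), first step, with (8.1) and Ch. I (11.5). [cite: NeukirchANT1999, Ch. II §9 Prop. (9.6) (proof)] -/
theorem embAbv_eq_and_exists_mul_eq_sepPart (φ : AlgebraicClosure F →ₐ[F] Ω)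
    (τ : absoluteGaloisGroup F)
    (hτ : ∀ b ∈ absIntegers v.1 F, sN (φ b) < 1 ↔ sN (φ (τ • b)) < 1) (x : AlgebraicClosure F) :
    (∀ y ∈ sepPart x, sN (φ (τ • y)) = sN (φ y)) ∧
      ∀ y ∈ sepPart x, sN (φ y) ≤ 1 → ∃ a ∈ absIntegers v.1 F, ∃ s ∈ absIntegers v.1 F,
        ¬ sN (φ s) < 1 ∧ y * s = a := by
  set M : IntermediateField F (AlgebraicClosure F) := sepPart x with hMdef
  haveI : FiniteDimensional F M := finiteDimensional_sepPart x
  haveI : Algebra.IsSeparable F M := isSeparable_sepPart x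
  -- the integral closure `R` of `O_v` in `M`, a Dedekind domain with fraction field `M`
  haveI : IsScalarTower v.1 M (AlgebraicClosure F) := IsScalarTower.of_algebraMap_eq fun _ ↦ rfl
  let R := integralClosure v.1 M
  haveI : IsFractionRing R M := integralClosure.isFractionRing_of_finite_extension F M
  haveI : IsDedekindDomain R := integralClosure.isDedekindDomain v.1 F M
  have hRabs : ∀ r : R, ((r : M) : AlgebraicClosure F) ∈ absIntegers v.1 F := fun r ↦ by
    rw [absIntegers, mem_integralClosure_iff]
    exact (r.2 : IsIntegral v.1 (r : M)).map (IsScalarTower.toAlgHom v.1 M (AlgebraicClosure F))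
  -- `τ` as an `F`-algebra map and the two absolute values on `M`
  let τ' : AlgebraicClosure F →ₐ[F] AlgebraicClosure F :=
    (absoluteGaloisGroup.toAlgEquiv F τ : AlgebraicClosure F ≃ₐ[F] AlgebraicClosure F)
  have hτ' : ∀ y, τ' y = τ • y := fun y ↦ rfl
  let ι : M →+* AlgebraicClosure F := algebraMap M (AlgebraicClosure F)
  have hι : Function.Injective ι := (algebraMap M (AlgebraicClosure F)).injective
  let N₁ := (embAbv v φ).comp hι
  let N₂ := (embAbv v (φ.comp τ')).comp hι
  have hN₁ := AbsoluteValue.isNonarchimedean_comp (isNonarchimedean_embAbv φ) hι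
  have hN₂ := AbsoluteValue.isNonarchimedean_comp (isNonarchimedean_embAbv (φ.comp τ')) hι
  have hR₁ : ∀ r : R, N₁ (algebraMap R M r) ≤ 1 := fun r ↦
    embAbv_le_one_of_mem_absIntegers φ (hRabs r)
  have hR₂ : ∀ r : R, N₂ (algebraMap R M r) ≤ 1 := fun r ↦
    embAbv_le_one_of_mem_absIntegers (φ.comp τ') (hRabs r)
  -- a uniformiser `π` of `v`: nonzero, in `𝔪_v`
  obtain ⟨π, hπv, hπ0⟩ := Submodule.exists_mem_ne_zero_of_ne_bot (v.spectrum).ne_bot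
  have hπM : ι (algebraMap R M (algebraMap v.1 R π)) =
      algebraMap v.1 (AlgebraicClosure F) π := by
    change (((algebraMap v.1 R π : R) : M) : AlgebraicClosure F) = _
    rw [IsScalarTower.algebraMap_apply v.1 M (AlgebraicClosure F)]
    rfl
  have hπ1 : N₁ (algebraMap R M (algebraMap v.1 R π)) < 1 := by
    change embAbv v φ (ι _) < 1
    rw [hπM]
    exact embAbv_algebraMap_lt_one φ hπv
  have hπR0 : algebraMap v.1 R π ≠ 0 := by
    intro h
    have h' : ι (algebraMap R M (algebraMap v.1 R π)) = 0 := by rw [h, map_zero, map_zero]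
    rw [hπM, IsScalarTower.algebraMap_apply v.1 F (AlgebraicClosure F), map_eq_zero,
      map_eq_zero_iff _ (FaithfulSMul.algebraMap_injective v.1 F)] at h'
    exact hπ0 h'
  -- the common prime
  let 𝔭 : HeightOneSpectrum R := ltOnePrime N₁ hN₁ hR₁ hπR0 hπ1
  have h₁ : ∀ r : R, r ∈ 𝔭.asIdeal ↔ N₁ (algebraMap R M r) < 1 := fun r ↦ Iff.rfl
  have h₂ : ∀ r : R, r ∈ 𝔭.asIdeal ↔ N₂ (algebraMap R M r) < 1 := fun r ↦ by
    rw [h₁ r]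
    change sN (φ _) < 1 ↔ sN (φ (τ' _)) < 1
    rw [hτ']
    exact hτ _ (hRabs r)
  -- agreement at `π`
  have ha₁ : N₁ (algebraMap R M (algebraMap v.1 R π)) =
      embAbv v φ (algebraMap v.1 (AlgebraicClosure F) π) := by
    change embAbv v φ (ι _) = _
    rw [hπM]
  have ha₂ : N₂ (algebraMap R M (algebraMap v.1 R π)) =
      embAbv v φ (algebraMap v.1 (AlgebraicClosure F) π) := by
    change embAbv v (φ.comp τ') (ι _) = _
    rw [hπM, embAbv_apply, embAbv_apply, AlgHom.comp_apply,
      IsScalarTower.algebraMap_apply v.1 F (AlgebraicClosure F), τ'.commutes]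
  have ha : N₁ (algebraMap R M (algebraMap v.1 R π)) = N₂ (algebraMap R M (algebraMap v.1 R π)) :=
    ha₁.trans ha₂.symm
  have ha₀ : algebraMap R M (algebraMap v.1 R π) ≠ 0 := fun h ↦ hπR0
    ((map_eq_zero_iff _ (IsFractionRing.injective R M)).mp h)
  have hN := absoluteValue_eq_of_prime_eq N₁ N₂ hN₁ hN₂ hR₁ hR₂ 𝔭 h₁ h₂ ha hπ1.ne ha₀
  refine ⟨fun y hy ↦ ?_, fun y hy hy1 ↦ ?_⟩
  · have hxy := congrArg (fun N : AbsoluteValue M ℝ ↦ N ⟨y, hy⟩) hN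
    exact hxy.symm
  · have hy' : N₁ ⟨y, hy⟩ ≤ 1 := hy1
    obtain ⟨a, s, hs, has⟩ := exists_mul_eq_of_absoluteValue_le_one N₁ hN₁ hR₁ 𝔭 h₁ hy'
    refine ⟨_, hRabs a, _, hRabs s, fun h ↦ hs ((h₁ s).mpr h), ?_⟩
    have := congrArg ι has
    rwa [map_mul] at this

/-! ## §C. Decomposition elements are isometries moving integral elements by `< 1` -/

/-- **An element of the decomposition group is an isometry for `‖φ ·‖_v`** (Neukirch II (9.6),
first step): if `τ ∈ Γ_F` preserves the condition `‖φ b‖ < 1` on `\bar O_v`, then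
`‖φ (τ x)‖ = ‖φ x‖` for all `x ∈ F̄`: it holds on the separable part of `F(x)`
(`embAbv_eq_and_exists_mul_eq_sepPart`), which contains `x^{q^e}`, and `q^e`-th powers are
injective on `ℝ≥0`. [cite: NeukirchANT1999, Ch. II §9 Prop. (9.6) (proof)] -/
theorem spectralNorm_apply_smul_eq (φ : AlgebraicClosure F →ₐ[F] Ω) (τ : absoluteGaloisGroup F)
    (hτ : ∀ b ∈ absIntegers v.1 F, sN (φ b) < 1 ↔ sN (φ (τ • b)) < 1)
    (x : AlgebraicClosure F) : sN (φ (τ • x)) = sN (φ x) := by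
  letI : NormedField Ω := spectralNorm.normedField Fᵥ Ω
  obtain ⟨e, he⟩ := exists_pow_mem_sepPart x
  have h := (embAbv_eq_and_exists_mul_eq_sepPart φ τ hτ x).1 _ he
  rw [smul_pow', map_pow, map_pow] at h
  change ‖φ (τ • x) ^ ringExpChar F ^ e‖ = ‖φ x ^ ringExpChar F ^ e‖ at h
  rw [norm_pow, norm_pow] at h
  exact (pow_left_inj₀ (norm_nonneg _) (norm_nonneg _) (pow_ne_zero e (expChar_pos F _).ne')).mp h

/-- **Fractions.** An element of `F̄` of `‖φ ·‖_v`-norm `≤ 1` is a quotient `a / s` of absolute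
integers with `‖φ s‖_v = 1`: for `x^{q^e} = a₀/s` at the separable level
(`embAbv_eq_and_exists_mul_eq_sepPart`), `(x s)^{q^e} = a₀ s^{q^e - 1} ∈ \bar O_v`, so
`x s ∈ \bar O_v` (`IsIntegral.of_pow`). Neukirch, *ANT*, Ch. I (11.5), Ch. II (8.1).
[cite: NeukirchANT1999, Ch. I (11.5)] -/
theorem exists_mul_eq_of_spectralNorm_apply_le_one (φ : AlgebraicClosure F →ₐ[F] Ω)
    {x : AlgebraicClosure F} (hx : sN (φ x) ≤ 1) :
    ∃ a ∈ absIntegers v.1 F, ∃ s ∈ absIntegers v.1 F, ¬ sN (φ s) < 1 ∧ x * s = a := by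
  letI : NormedField Ω := spectralNorm.normedField Fᵥ Ω
  obtain ⟨e, he⟩ := exists_pow_mem_sepPart x
  set Q := ringExpChar F ^ e with hQdef
  have hQ : 0 < Q := pow_pos (expChar_pos F _) e
  have hxQ : sN (φ (x ^ Q)) ≤ 1 := by
    change ‖φ (x ^ Q)‖ ≤ 1
    rw [map_pow, norm_pow]
    exact pow_le_one₀ (norm_nonneg _) hx
  obtain ⟨a, ha, s, hs, hs1, hxs⟩ :=
    (embAbv_eq_and_exists_mul_eq_sepPart φ 1 (fun b _ ↦ by rw [one_smul]) x).2 _ he hxQ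
  refine ⟨x * s, ?_, s, hs, hs1, rfl⟩
  -- `(x s)^Q = x^Q s · s^{Q-1} = a s^{Q-1}` is an absolute integer
  have hmem : (x * s) ^ Q ∈ absIntegers v.1 F := by
    have h1 : (x * s) ^ Q = a * s ^ (Q - 1) := by
      rw [mul_pow, ← hxs, mul_assoc, ← pow_succ', Nat.sub_add_cancel hQ]
    rw [h1]
    exact mul_mem ha (pow_mem hs _)
  rw [absIntegers, mem_integralClosure_iff] at hmem ⊢
  exact IsIntegral.of_pow hQ hmem

/-- **Inertia elements move `v`-integral elements by less than `1`.** If `τ ∈ Γ_F` satisfies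
`‖φ (τ b) - φ b‖ < 1` for all absolute integers `b` (i.e. `τ ∈ I_{𝔓_{φ,𝔐}}`), then the same holds
for every `x ∈ F̄` with `‖φ x‖ ≤ 1` (write `x = a / s` and expand ultrametrically). Neukirch,
*ANT*, Ch. II (9.3) Definition. [cite: NeukirchANT1999, Ch. II (9.3) Definition] -/
theorem spectralNorm_apply_smul_sub_lt_one (φ : AlgebraicClosure F →ₐ[F] Ω)
    (τ : absoluteGaloisGroup F)
    (hτ : ∀ b ∈ absIntegers v.1 F, sN (φ (τ • b) - φ b) < 1)
    {x : AlgebraicClosure F} (hx : sN (φ x) ≤ 1) : sN (φ (τ • x) - φ x) < 1 := by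
  letI : NormedField Ω := spectralNorm.normedField Fᵥ Ω
  have hiu : IsUltrametricDist Ω :=
    IsUltrametricDist.isUltrametricDist_of_isNonarchimedean_norm isNonarchimedean_spectralNorm
  obtain ⟨a, ha, s, hs, hs1, hxs⟩ := exists_mul_eq_of_spectralNorm_apply_le_one φ hx
  change ¬ ‖φ s‖ < 1 at hs1
  change ‖φ (τ • x) - φ x‖ < 1
  have hs1' : ‖φ s‖ = 1 :=
    le_antisymm ((Place.mem_absIntegers_completion_iff v).mp ((mem_integralClosure_iff _ _).mpr
      (Place.isIntegral_apply_of_mem_absIntegers v φ hs))) (not_lt.mp hs1)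
  have ha1 : ‖φ a‖ ≤ 1 := (Place.mem_absIntegers_completion_iff v).mp
    ((mem_integralClosure_iff _ _).mpr (Place.isIntegral_apply_of_mem_absIntegers v φ ha))
  have hτs : ‖φ (τ • s) - φ s‖ < 1 := hτ s hs
  have hτa : ‖φ (τ • a) - φ a‖ < 1 := hτ a ha
  have hτs1 : ‖φ (τ • s)‖ = 1 := by
    have h : φ (τ • s) = φ s + (φ (τ • s) - φ s) := by abel
    rw [h, IsUltrametricDist.norm_add_eq_max_of_norm_ne_norm, hs1', max_eq_left hτs.le]
    rw [hs1']
    exact (hτs.trans_le le_rfl).ne'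
  have hs0 : φ s ≠ 0 := by
    intro h; rw [h, norm_zero] at hs1'; exact zero_ne_one hs1'
  have hτs0 : φ (τ • s) ≠ 0 := by
    intro h; rw [h, norm_zero] at hτs1; exact zero_ne_one hτs1
  have hX : φ x = φ a / φ s := by
    rw [eq_div_iff hs0, ← map_mul, hxs]
  have hX' : φ (τ • x) = φ (τ • a) / φ (τ • s) := by
    rw [eq_div_iff hτs0, ← map_mul, ← smul_mul', hxs]
  rw [hX, hX', div_sub_div _ _ hτs0 hs0, norm_div, norm_mul, hτs1, hs1', mul_one, div_one]
  have h : φ (τ • a) * φ s - φ (τ • s) * φ a =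
      (φ (τ • a) - φ a) * φ s + φ a * (φ s - φ (τ • s)) := by ring
  rw [h]
  refine (IsUltrametricDist.norm_add_le_max _ _).trans_lt (max_lt ?_ ?_)
  · rw [norm_mul, hs1', mul_one]; exact hτa
  · rw [norm_mul, norm_sub_rev]
    exact mul_lt_one_of_nonneg_of_lt_one_right ha1 (norm_nonneg _) hτs

/-! ## §D. Extension of decomposition elements to `Gal(F̄_v/F_v)` -/

/-- **The minimal polynomial of `φ α` over `F_v` vanishes at `φ (τ α)`** when `τ ∈ Γ_F` is an
isometry of `‖φ ·‖_v` ("extension by continuity", Neukirch II (9.6); `F` is dense in `F_v`).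
The tree's `aeval_apply_smul_minpoly_eq_zero` at a place. [cite: NeukirchANT1999, Ch. II §9 Prop. (9.6) (proof)] -/
theorem aeval_apply_smul_minpoly_eq_zero (φ : AlgebraicClosure F →ₐ[F] Ω)
    (τ : absoluteGaloisGroup F) (hiso : ∀ x, sN (φ (τ • x)) = sN (φ x))
    (α : AlgebraicClosure F) : aeval (φ (τ • α)) (minpoly Fᵥ (φ α)) = 0 := by
  letI : NormedField Ω := spectralNorm.normedField Fᵥ Ω
  have hext : ∀ y : Fᵥ, ‖algebraMap Fᵥ Ω y‖ = ‖y‖ := fun y ↦ spectralNorm_extends y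
  let τ' : AlgebraicClosure F →ₐ[F] AlgebraicClosure F :=
    (absoluteGaloisGroup.toAlgEquiv F τ : AlgebraicClosure F ≃ₐ[F] AlgebraicClosure F)
  have hτ' : ∀ y, τ' y = τ • y := fun y ↦ rfl
  have hint : IsIntegral Fᵥ (φ α) := Algebra.IsIntegral.isIntegral _
  set g := minpoly Fᵥ (φ α) with hgdef
  have hgm : g.Monic := minpoly.monic hint
  set n := g.natDegree with hndef
  set y := φ (τ • α) with hydef
  have hy : ‖y‖ = ‖φ α‖ := hiso α
  set B := max ‖φ α‖ 1 with hBdef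
  have hB : 0 < B := lt_of_lt_of_le zero_lt_one (le_max_right _ _)
  by_contra hne
  set c := ‖aeval y g‖ with hcdef
  have hc : 0 < c := norm_pos_iff.mpr hne
  set ε := c / (4 * ((n + 1) * B ^ n)) with hεdef
  have hden : 0 < 4 * ((n + 1) * B ^ n) := by positivity
  have hε : 0 < ε := div_pos hc hden
  obtain ⟨h, -, hdeg, hcoef⟩ :=
    exists_monic_and_natDegree_eq_and_norm_map_algebraMap_coeff_sub_lt
      (HeightOneSpectrum.denseRange_algebraMap F v.spectrum) hgm hε
  set G : Polynomial Ω := g.map (algebraMap Fᵥ Ω) with hGdef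
  set H : Polynomial Ω := (h.map (algebraMap F Fᵥ)).map (algebraMap Fᵥ Ω) with hHdef
  have hGn : G.natDegree ≤ n := natDegree_map_le
  have hHn : H.natDegree ≤ n := by
    refine natDegree_map_le.trans (natDegree_map_le.trans ?_)
    rw [hndef, hdeg]
  have hcoefΩ : ∀ i, ‖H.coeff i - G.coeff i‖ ≤ ε := fun i ↦ by
    rw [hHdef, hGdef, coeff_map (p := h.map (algebraMap F Fᵥ)), coeff_map (p := g), ← map_sub,
      hext]
    exact (hcoef i).le
  have hH : H = h.map (algebraMap F Ω) := by
    rw [hHdef, Polynomial.map_map, ← IsScalarTower.algebraMap_eq F Fᵥ Ω]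
  have hHα : H.eval (φ α) = φ (aeval α h) := by
    rw [hH, eval_map_algebraMap, aeval_algHom_apply]
  have hHy : H.eval y = φ (τ • aeval α h) := by
    rw [hH, eval_map_algebraMap]
    change aeval ((φ.comp τ') α) h = φ (τ' (aeval α h))
    rw [aeval_algHom_apply, AlgHom.comp_apply]
  have hGα : G.eval (φ α) = 0 := by rw [hGdef, eval_map_algebraMap]; exact minpoly.aeval Fᵥ (φ α)
  have hGy : G.eval y = aeval y g := by rw [hGdef, eval_map_algebraMap]
  have hkey : (n + 1) * ε * B ^ n = c / 4 := by
    rw [hεdef]; field_simp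
  have h1 : ‖H.eval y - G.eval y‖ ≤ c / 4 := by
    have := norm_eval_sub_eval_le hGn hHn y hε.le hcoefΩ
    rwa [hy, ← hBdef, hkey] at this
  have h2 : ‖H.eval y‖ ≤ c / 4 := by
    rw [hHy]
    change sN (φ (τ • aeval α h)) ≤ c / 4
    rw [hiso]
    change ‖φ (aeval α h)‖ ≤ c / 4
    rw [← hHα, ← sub_zero (H.eval (φ α)), ← hGα]
    have := norm_eval_sub_eval_le hGn hHn (φ α) hε.le hcoefΩ
    rwa [← hBdef, hkey] at this
  have h3 : c ≤ c / 4 + c / 4 := by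
    calc c = ‖G.eval y‖ := by rw [hGy]
      _ = ‖(G.eval y - H.eval y) + H.eval y‖ := by rw [sub_add_cancel]
      _ ≤ ‖G.eval y - H.eval y‖ + ‖H.eval y‖ := norm_add_le _ _
      _ ≤ c / 4 + c / 4 := by rw [norm_sub_rev]; exact add_le_add h1 h2
  linarith

/-- **Extension to `Gal(F̄_v/F_v)` on a simple subextension** (Neukirch II (9.6), surjectivity of
`G(L_w|K_v) → G_w(L|K)` at the finite level): for an isometry `τ ∈ Γ_F` of `‖φ ·‖_v` and `α ∈ F̄`
there is `σ ∈ Γ_{F_v}` with `σ (φ y) = φ (τ y)` for all `y ∈ F[α]`. The tree's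
`exists_absoluteGaloisGroup_smul_apply_eq` at a place. [cite: NeukirchANT1999, Ch. II §9 Prop. (9.6)] -/
theorem exists_absoluteGaloisGroup_smul_apply_eq (φ : AlgebraicClosure F →ₐ[F] Ω)
    (τ : absoluteGaloisGroup F) (hiso : ∀ x, sN (φ (τ • x)) = sN (φ x))
    (α : AlgebraicClosure F) :
    ∃ σ : absoluteGaloisGroup Fᵥ, ∀ p : F[X], σ • φ (aeval α p) = φ (τ • aeval α p) := by
  let τ' : AlgebraicClosure F →ₐ[F] AlgebraicClosure F :=
    (absoluteGaloisGroup.toAlgEquiv F τ : AlgebraicClosure F ≃ₐ[F] AlgebraicClosure F)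
  have hτ' : ∀ y, τ' y = τ • y := fun y ↦ rfl
  have hint : IsIntegral Fᵥ (φ α) := Algebra.IsIntegral.isIntegral _
  have hroot : φ (τ • α) ∈ (minpoly Fᵥ (φ α)).aroots Ω :=
    mem_aroots.mpr ⟨minpoly.ne_zero hint, aeval_apply_smul_minpoly_eq_zero φ τ hiso α⟩
  let ψ : Fᵥ⟮φ α⟯ →ₐ[Fᵥ] Ω :=
    (IntermediateField.algHomAdjoinIntegralEquiv Fᵥ hint).symm ⟨φ (τ • α), hroot⟩
  have hψ : ψ (IntermediateField.AdjoinSimple.gen Fᵥ (φ α)) = φ (τ • α) :=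
    IntermediateField.algHomAdjoinIntegralEquiv_symm_apply_gen Fᵥ hint _
  let ψ' : Ω →ₐ[Fᵥ] Ω := ψ.liftNormal Ω
  have hψ' : ψ' (φ α) = φ (τ • α) := by
    have := AlgHom.liftNormal_commutes ψ Ω (IntermediateField.AdjoinSimple.gen Fᵥ (φ α))
    rw [hψ] at this
    exact this
  let σ : Ω ≃ₐ[Fᵥ] Ω := AlgEquiv.ofBijective ψ' (Algebra.IsAlgebraic.algHom_bijective ψ')
  refine ⟨(absoluteGaloisGroup.toAlgEquiv Fᵥ).symm σ, fun p ↦ ?_⟩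
  rw [absoluteGaloisGroup.toAlgEquiv_symm_apply]
  change ψ' (φ (aeval α p)) = φ (τ • aeval α p)
  calc ψ' (φ (aeval α p)) = (ψ'.restrictScalars F) (aeval (φ α) p) := by
        rw [aeval_algHom_apply]; rfl
    _ = aeval (φ (τ • α)) p := by rw [← aeval_algHom_apply, AlgHom.restrictScalars_apply, hψ']
    _ = aeval ((φ.comp τ') α) p := by rw [AlgHom.comp_apply, hτ']
    _ = φ (τ • aeval α p) := by rw [aeval_algHom_apply, AlgHom.comp_apply, hτ']

/-! ## §E. `φ(F[α])` is dense in `F_v(φ α)`; correction into the local inertia group -/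

/-- `φ (p(α)) = p(φ α)` lies in `F_v(φ α)` for `p ∈ F[X]`. [folklore] -/
theorem apply_aeval_mem_adjoin_simple (φ : AlgebraicClosure F →ₐ[F] Ω) (α : AlgebraicClosure F)
    (r : F[X]) : φ (aeval α r) ∈ Fᵥ⟮φ α⟯ := by
  rw [← aeval_algHom_apply, ← aeval_map_algebraMap Fᵥ (φ α) r]
  exact IntermediateField.algebra_adjoin_le_adjoin Fᵥ _ (Polynomial.aeval_mem_adjoin_singleton Fᵥ _)

/-- **`φ(F[α])` is dense in `F_v(φ α)`**: every `b ∈ F_v(φ α)` is within any `δ > 0` of some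
`φ (r(α))`, `r ∈ F[X]`. The tree's `exists_spectralNorm_sub_apply_aeval_lt` at a place.
[cite: NeukirchANT1999, Ch. II §9 Prop. (9.6) (proof)] -/
theorem exists_spectralNorm_sub_apply_aeval_lt (φ : AlgebraicClosure F →ₐ[F] Ω)
    (α : AlgebraicClosure F) {b : Ω} (hb : b ∈ Fᵥ⟮φ α⟯) {δ : ℝ} (hδ : 0 < δ) :
    ∃ r : F[X], sN (b - φ (aeval α r)) < δ := by
  letI : NormedField Ω := spectralNorm.normedField Fᵥ Ω
  have hext : ∀ y : Fᵥ, ‖algebraMap Fᵥ Ω y‖ = ‖y‖ := fun y ↦ spectralNorm_extends y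
  have hint : IsIntegral Fᵥ (φ α) := Algebra.IsIntegral.isIntegral _
  obtain ⟨g, rfl⟩ : ∃ g : Fᵥ[X], b = aeval (φ α) g :=
    (mem_adjoin_simple_iff_exists_aeval hint).mp hb
  set n := g.natDegree with hndef
  have hdeg : g.degree < ((n + 1 : ℕ) : WithBot ℕ) :=
    degree_le_natDegree.trans_lt (by exact_mod_cast Nat.lt_succ_self n)
  set G : Fᵥ[X] := X ^ (n + 1) + g with hGdef
  have hGm : G.Monic := monic_X_pow_add hdeg
  have hGn : G.natDegree = n + 1 := by
    rw [hGdef, natDegree_add_eq_left_of_degree_lt, natDegree_X_pow]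
    rwa [degree_X_pow]
  set B := max ‖φ α‖ 1 with hBdef
  have hB : 0 < B := lt_of_lt_of_le zero_lt_one (le_max_right _ _)
  set ε := δ / (2 * ((↑(n + 1) + 1) * B ^ (n + 1))) with hεdef
  have hden : (0 : ℝ) < 2 * ((↑(n + 1) + 1) * B ^ (n + 1)) := by positivity
  have hε : 0 < ε := div_pos hδ hden
  obtain ⟨h, -, hdeg', hcoef⟩ :=
    exists_monic_and_natDegree_eq_and_norm_map_algebraMap_coeff_sub_lt
      (HeightOneSpectrum.denseRange_algebraMap F v.spectrum) hGm hε
  refine ⟨h - X ^ (n + 1), ?_⟩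
  set Gm : Polynomial Ω := G.map (algebraMap Fᵥ Ω) with hGmdef
  set Hm : Polynomial Ω := (h.map (algebraMap F Fᵥ)).map (algebraMap Fᵥ Ω) with hHmdef
  have hGmn : Gm.natDegree ≤ n + 1 := natDegree_map_le.trans hGn.le
  have hHmn : Hm.natDegree ≤ n + 1 := by
    refine natDegree_map_le.trans (natDegree_map_le.trans ?_)
    rw [← hdeg', hGn]
  have hcoefΩ : ∀ i, ‖Hm.coeff i - Gm.coeff i‖ ≤ ε := fun i ↦ by
    rw [hHmdef, hGmdef, coeff_map (p := h.map (algebraMap F Fᵥ)), coeff_map (p := G), ← map_sub,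
      hext]
    exact (hcoef i).le
  have hHm : Hm = h.map (algebraMap F Ω) := by
    rw [hHmdef, Polynomial.map_map, ← IsScalarTower.algebraMap_eq F Fᵥ Ω]
  have hHmα : Hm.eval (φ α) = φ (aeval α h) := by
    rw [hHm, eval_map_algebraMap, aeval_algHom_apply]
  have hGmα : Gm.eval (φ α) = φ α ^ (n + 1) + aeval (φ α) g := by
    rw [hGmdef, eval_map_algebraMap, hGdef, map_add, map_pow, aeval_X]
  have hdiff : aeval (φ α) g - φ (aeval α (h - X ^ (n + 1))) = Gm.eval (φ α) - Hm.eval (φ α) := by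
    rw [hHmα, hGmα, map_sub, map_sub, map_pow, aeval_X, map_pow]
    ring
  change ‖aeval (φ α) g - φ (aeval α (h - X ^ (n + 1)))‖ < δ
  rw [hdiff, norm_sub_rev]
  have hkey : (↑(n + 1) + 1) * ε * B ^ (n + 1) = δ / 2 := by
    rw [hεdef]
    field_simp
  calc ‖Hm.eval (φ α) - Gm.eval (φ α)‖ ≤ (↑(n + 1) + 1) * ε * B ^ (n + 1) :=
        norm_eval_sub_eval_le hGmn hHmn (φ α) hε.le hcoefΩ
    _ = δ / 2 := hkey
    _ < δ := half_lt_self hδ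

/-- **Correction into the local inertia group** (Neukirch II (9.6), the inertia part), every
characteristic. Let `τ ∈ Γ_F` be an isometry for `‖φ ·‖_v` moving `v`-integral elements by less
than `1`, and `α ∈ F̄` with `τ α ∈ F[α]`. Then some element of the local inertia group
`I_𝔐 ≤ Γ_{F_v}` induces `φ ∘ τ ∘ φ⁻¹` on `φ(F[α])`: extend `τ` to `σ₀ ∈ Γ_{F_v}`
(`exists_absoluteGaloisGroup_smul_apply_eq`); an absolute integer `b` of `F̄_v` invariant under
`N = Aut(F̄_v / F_v(φ α))` is purely inseparable over `F_v(φ α)` — some `b^{q^m}` lies in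
`F_v(φ α)` (`mem_perfectClosure_of_forall_algEquiv_apply_eq_of_isAlgClosed`) — and `σ₀` moves
`b^{q^m}` by less than `1` (density of `φ(F[α])`, isometry of `Γ_{F_v}`), hence also `b`
(`(σ₀ b - b)^{q^m} = σ₀ b^{q^m} - b^{q^m}`); so `σ₀` is inertial on the `N`-invariants and
`exists_mul_mul_mem_inertia` (`InertiaLift`) corrects it by elements of `N` into `I_𝔐`.
[cite: NeukirchANT1999, Ch. II §9 Prop. (9.6), with (9.9)] -/
theorem exists_mem_inertia_smul_apply_aeval_eq (φ : AlgebraicClosure F →ₐ[F] Ω)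
    (τ : absoluteGaloisGroup F) (hiso : ∀ x, sN (φ (τ • x)) = sN (φ x))
    (hkey : ∀ x, sN (φ x) ≤ 1 → sN (φ (τ • x) - φ x) < 1)
    {𝔐 : Ideal (Place.localAbsIntegers v)} (h𝔐 : 𝔐 ∈ v.localPrimesAbove)
    {α : AlgebraicClosure F} (hα : ∃ q : F[X], τ • α = aeval α q) :
    ∃ σ ∈ 𝔐.inertia (absoluteGaloisGroup Fᵥ),
      ∀ p : F[X], σ • φ (aeval α p) = φ (τ • aeval α p) := by
  haveI := h𝔐.1
  haveI := h𝔐.2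
  letI : NormedField Ω := spectralNorm.normedField Fᵥ Ω
  have hiu : IsUltrametricDist Ω :=
    IsUltrametricDist.isUltrametricDist_of_isNonarchimedean_norm isNonarchimedean_spectralNorm
  obtain ⟨σ₀, hσ₀⟩ := exists_absoluteGaloisGroup_smul_apply_eq φ τ hiso α
  obtain ⟨q, hq⟩ := hα
  -- `τ` maps `F[α]` into itself
  let τ' : AlgebraicClosure F →ₐ[F] AlgebraicClosure F :=
    (absoluteGaloisGroup.toAlgEquiv F τ : AlgebraicClosure F ≃ₐ[F] AlgebraicClosure F)
  have hτ' : ∀ y, τ' y = τ • y := fun y ↦ rfl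
  have hτp : ∀ p : F[X], τ • aeval α p = aeval α (p.comp q) := fun p ↦ by
    rw [← hτ', ← aeval_algHom_apply, hτ', hq, aeval_comp]
  -- profinite set-up: `Γ_{F_v}` acting on the discrete ring `\bar O_{F_v}`
  letI : TopologicalSpace (Place.localAbsIntegers v) := ⊥
  haveI : DiscreteTopology (Place.localAbsIntegers v) := ⟨rfl⟩
  haveI : ContinuousSMul (absoluteGaloisGroup Fᵥ) (Place.localAbsIntegers v) :=
    GaloisRepresentations.absIntegers.continuousSMul v.CompletionIntegers
  haveI : CompactSpace (absoluteGaloisGroup Fᵥ) := absoluteGaloisGroup_compactSpace Fᵥ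
  have hint : IsIntegral Fᵥ (φ α) := Algebra.IsIntegral.isIntegral _
  set E : IntermediateField Fᵥ Ω := Fᵥ⟮φ α⟯ with hEdef
  haveI : FiniteDimensional Fᵥ E := IntermediateField.adjoin.finiteDimensional hint
  let N : Subgroup (absoluteGaloisGroup Fᵥ) :=
    E.fixingSubgroup.comap (absoluteGaloisGroup.toAlgEquiv Fᵥ).toMonoidHom
  have hmemN : ∀ n : absoluteGaloisGroup Fᵥ, n ∈ N ↔ ∀ e ∈ E, n • e = e := fun n ↦ by
    change absoluteGaloisGroup.toAlgEquiv Fᵥ n ∈ E.fixingSubgroup ↔ _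
    rw [IntermediateField.mem_fixingSubgroup_iff]
    rfl
  have hcont : Continuous (absoluteGaloisGroup.toAlgEquiv Fᵥ) := continuous_id
  have hN : IsClosed (N : Set (absoluteGaloisGroup Fᵥ)) :=
    (IntermediateField.fixingSubgroup_isClosed E).preimage hcont
  -- the estimate `‖σ₀ c - c‖ < 1` for `c ∈ E` with `‖c‖ ≤ 1`
  have hest : ∀ c : Ω, c ∈ E → ‖c‖ ≤ 1 → ‖σ₀ • c - c‖ < 1 := by
    intro c hcE hc1
    obtain ⟨r, hr⟩ := exists_spectralNorm_sub_apply_aeval_lt φ α hcE zero_lt_one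
    change ‖c - φ (aeval α r)‖ < 1 at hr
    set y := φ (aeval α r) with hydef
    have hy1 : ‖y‖ ≤ 1 := by
      have : y = c - (c - y) := (sub_sub_cancel _ _).symm
      rw [this]
      exact (norm_sub_le_max_of_isUltrametricDist _ _).trans (max_le hc1 hr.le)
    have h1 : ‖σ₀ • (c - y)‖ < 1 := by
      change sN _ < 1
      rw [GaloisRepresentations.spectralNorm_absoluteGaloisGroup_smul]
      exact hr
    have h2 : ‖σ₀ • y - y‖ < 1 := by
      rw [hydef, hσ₀]
      exact hkey _ hy1
    have h3 : ‖y - c‖ < 1 := by rw [norm_sub_rev]; exact hr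
    have hdecomp : σ₀ • c - c = σ₀ • (c - y) + ((σ₀ • y - y) + (y - c)) := by
      rw [smul_sub]; abel
    rw [hdecomp]
    refine (hiu.norm_add_le_max _ _).trans_lt (max_lt h1 ?_)
    exact (hiu.norm_add_le_max _ _).trans_lt (max_lt h2 h3)
  -- `σ₀` is inertial on the `N`-invariants of `\bar O_{F_v}` (which are purely inseparable over `E`)
  have hg : ∀ b : Place.localAbsIntegers v, (∀ n ∈ N, n • b = b) → σ₀ • b - b ∈ 𝔐 := by
    intro b hb
    -- `b` is fixed by `Aut(Ω/E)`, hence lies in the perfect closure of `E`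
    haveI : IsAlgClosure E Ω := ⟨inferInstance, inferInstance⟩
    have hbfix : ∀ σ : Ω ≃ₐ[E] Ω, σ (b : Ω) = b := by
      intro σ
      have h1 : (absoluteGaloisGroup.toAlgEquiv Fᵥ).symm (σ.restrictScalars Fᵥ) ∈ N := by
        change absoluteGaloisGroup.toAlgEquiv Fᵥ
          ((absoluteGaloisGroup.toAlgEquiv Fᵥ).symm (σ.restrictScalars Fᵥ)) ∈ E.fixingSubgroup
        rw [MulEquiv.apply_symm_apply, IntermediateField.mem_fixingSubgroup_iff]
        intro e he
        exact σ.commutes ⟨e, he⟩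
      have := congrArg Subtype.val (hb _ h1)
      rwa [integralClosure.coe_smul, absoluteGaloisGroup.toAlgEquiv_symm_apply] at this
    obtain ⟨m, hm⟩ := mem_perfectClosure_iff.mp
      (mem_perfectClosure_of_forall_algEquiv_apply_eq_of_isAlgClosed hbfix)
    obtain ⟨c, hc⟩ := RingHom.mem_range.mp hm
    -- `c : E` with `c = b ^ Q`, `Q = q ^ m`
    set Q := ringExpChar E ^ m with hQdef
    haveI : ExpChar Ω (ringExpChar E) :=
      expChar_of_injective_ringHom (algebraMap E Ω).injective (ringExpChar E)
    have hQ : 0 < Q := pow_pos (expChar_pos E _) m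
    have hcΩ : (c : Ω) = (b : Ω) ^ Q := hc
    have hb1 : ‖(b : Ω)‖ ≤ 1 := (Place.mem_absIntegers_completion_iff v).mp b.2
    have hcE : ((c : Ω)) ∈ E := c.2
    have hc1 : ‖(c : Ω)‖ ≤ 1 := by
      rw [hcΩ, norm_pow]
      exact pow_le_one₀ (norm_nonneg _) hb1
    have hlt : ‖σ₀ • (c : Ω) - c‖ < 1 := hest _ hcE hc1
    -- `(σ₀ b - b)^Q = σ₀ b^Q - b^Q`
    have hpow : (σ₀ • (b : Ω) - b) ^ Q = σ₀ • (c : Ω) - c := by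
      rw [hQdef, sub_pow_expChar_pow, ← smul_pow', ← hQdef, ← hcΩ]
    rw [Place.mem_iff_spectralNorm_lt_one_completion v]
    change ‖((σ₀ • b - b : Place.localAbsIntegers v) : Ω)‖ < 1
    rw [AddSubgroupClass.coe_sub, integralClosure.coe_smul]
    have h := hlt
    rw [← hpow, norm_pow] at h
    exact (pow_lt_one_iff_of_nonneg (norm_nonneg _) hQ.ne').mp h
  obtain ⟨n, hn, n', hn', hσ⟩ := GaloisRepresentations.exists_mul_mul_mem_inertia N hN 𝔐 σ₀ hg
  refine ⟨n * σ₀ * n', hσ, fun p ↦ ?_⟩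
  rw [mul_smul, mul_smul, (hmemN n').mp hn' _ (apply_aeval_mem_adjoin_simple φ α p), hσ₀, hτp,
    (hmemN n).mp hn _ (apply_aeval_mem_adjoin_simple φ α (p.comp q))]

/-! ## §F. The local–global principle for inertia -/

/-- A finite **separable** subextension `E ⊆ F̄` is simple: `E = F(α)` (primitive element
theorem, `Field.exists_primitive_element`, transported along `IntermediateField.lift`).
[folklore] -/
theorem exists_eq_adjoin_simple_of_isSeparable (E : IntermediateField F (AlgebraicClosure F))
    [FiniteDimensional F E] [Algebra.IsSeparable F E] : ∃ α : AlgebraicClosure F, E = F⟮α⟯ := by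
  obtain ⟨a, ha⟩ := Field.exists_primitive_element F E
  refine ⟨a, ?_⟩
  have := congrArg IntermediateField.lift ha
  rw [IntermediateField.lift_adjoin_simple, IntermediateField.lift_top] at this
  exact this.symm

/-- An automorphism maps a normal subextension into itself: for `E = F(α)` normal and `τ ∈ Γ_F`,
`τ α ∈ F[α]`. [folklore] -/
theorem exists_smul_eq_aeval_of_normal (τ : absoluteGaloisGroup F) {α : AlgebraicClosure F}
    (hn : Normal F F⟮α⟯) : ∃ q : F[X], τ • α = aeval α q := by
  let τ' : AlgebraicClosure F ≃ₐ[F] AlgebraicClosure F := absoluteGaloisGroup.toAlgEquiv F τ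
  have hmem : τ' α ∈ F⟮α⟯ := by
    have h := AlgEquiv.restrictNormal_commutes τ' F⟮α⟯
      ⟨α, IntermediateField.mem_adjoin_simple_self F α⟩
    change algebraMap F⟮α⟯ (AlgebraicClosure F) _ = τ' α at h
    rw [← h]
    exact SetLike.coe_mem _
  exact (mem_adjoin_simple_iff_exists_aeval (Algebra.IsIntegral.isIntegral α)).mp hmem

/-- **Local inertia surjects onto global inertia at a place of a field, every characteristic**
(Neukirch, *ANT*, Ch. II §9 Prop. (9.6) with (9.9), for `L = F̄`): for a place `v` of `F`, an
`F`-embedding `ι : F̄ → F̄_v`, a prime `𝔐` of `\bar O_{F_v}` above `𝔪_{F_v}` and `τ` in the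
inertia group of the prime `𝔓_{ι,𝔐}` of `\bar O_v` cut out by `ι` and `𝔐`, there is `σ` in the
local inertia group `I_𝔐 ≤ Γ_{F_v}` with `ι ∘ τ = σ ∘ ι`. Proof as in the tree's
`exists_mem_inertia_apply_eq_holds'` (number fields): `τ` is an isometry of `‖ι ·‖_v`
(`spectralNorm_apply_smul_eq`) moving `v`-integral elements by less than `1`
(`spectralNorm_apply_smul_sub_lt_one`); on each finite normal `E ⊆ F̄` — through its separable
part `F(α) = E ∩ F^{sep}`, finite separable (hence simple), normal, with the same fixing group —
it extends to an element of `I_𝔐` (`exists_mem_inertia_smul_apply_aeval_eq`); as `I_𝔐` is compact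
and restriction `Γ_{F_v} → Γ_F` is continuous, these elements accumulate at a `σ ∈ I_𝔐`
restricting to `τ`. This is the hypothesis (LG) of `selmerGroup_le_h1Unramified_of_local`.
[cite: NeukirchANT1999, Ch. II §9 Prop. (9.6), with (9.9)] -/
theorem Place.exists_mem_inertia_apply_eq (ι : AlgebraicClosure F →ₐ[F] Ω)
    {𝔐 : Ideal (Place.localAbsIntegers v)} (h𝔐 : 𝔐 ∈ v.localPrimesAbove)
    {τ : absoluteGaloisGroup F} (hτ : τ ∈ (v.primeBelow ι 𝔐).inertia (absoluteGaloisGroup F)) :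
    ∃ σ ∈ 𝔐.inertia (absoluteGaloisGroup Fᵥ), ∀ x : AlgebraicClosure F, ι (τ • x) = σ • ι x := by
  haveI := h𝔐.1
  haveI := h𝔐.2
  letI : NormedField Ω := spectralNorm.normedField Fᵥ Ω
  have hiu : IsUltrametricDist Ω :=
    IsUltrametricDist.isUltrametricDist_of_isNonarchimedean_norm isNonarchimedean_spectralNorm
  haveI : CompactSpace (absoluteGaloisGroup Fᵥ) := absoluteGaloisGroup_compactSpace Fᵥ
  -- Step 0: `τ ∈ I_𝔓` in terms of norms
  have hτ0 : ∀ b ∈ absIntegers v.1 F, sN (ι (τ • b) - ι b) < 1 := by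
    intro b hb
    rw [Ideal.inertia, AddSubgroup.mem_inertia] at hτ
    have h := hτ ⟨b, hb⟩
    rw [Submodule.mem_toAddSubgroup, Place.mem_primeBelow_iff,
      Place.mem_iff_spectralNorm_lt_one_completion v] at h
    convert h using 2
    rw [Place.coe_absIntegersToLocal_apply, AddSubgroupClass.coe_sub,
      integralClosure.coe_smul, map_sub]
  -- Step 1: `τ` is an isometry moving integral elements by `< 1`
  have hiso : ∀ x, sN (ι (τ • x)) = sN (ι x) := by
    refine spectralNorm_apply_smul_eq ι τ fun b hb ↦ ?_
    have h := hτ0 b hb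
    change ‖ι (τ • b) - ι b‖ < 1 at h
    change ‖ι b‖ < 1 ↔ ‖ι (τ • b)‖ < 1
    constructor
    · intro hb1
      have : ι (τ • b) = ι b + (ι (τ • b) - ι b) := by abel
      rw [this]
      exact (hiu.norm_add_le_max _ _).trans_lt (max_lt hb1 h)
    · intro hb1
      have : ι b = ι (τ • b) - (ι (τ • b) - ι b) := by abel
      rw [this]
      exact (norm_sub_le_max_of_isUltrametricDist _ _).trans_lt (max_lt hb1 h)
  have hkey : ∀ x, sN (ι x) ≤ 1 → sN (ι (τ • x) - ι x) < 1 := fun x hx ↦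
    spectralNorm_apply_smul_sub_lt_one ι τ hτ0 hx
  -- Step 2: the closure argument
  set I : Subgroup (absoluteGaloisGroup Fᵥ) := 𝔐.inertia (absoluteGaloisGroup Fᵥ) with hIdef
  set res := resGalOfEmb ι with hres
  have hIc : IsCompact ((I : Set (absoluteGaloisGroup Fᵥ))) :=
    (GaloisRepresentations.absIntegers.isClosed_inertia_holds (R := v.CompletionIntegers)
      (K := Fᵥ) 𝔐).isCompact
  have hcl : IsClosed (res '' (I : Set (absoluteGaloisGroup Fᵥ))) :=
    (hIc.image res.continuous_toFun).isClosed
  suffices hmem : τ ∈ closure (res '' (I : Set (absoluteGaloisGroup Fᵥ))) by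
    rw [hcl.closure_eq] at hmem
    obtain ⟨σ, hσI, hστ⟩ := hmem
    refine ⟨σ, hσI, fun x ↦ ?_⟩
    have h := apply_resGalAuxOfEmb_apply ι σ x
    rw [← resGalOfEmb_apply, ← hres, hστ] at h
    exact h
  rw [mem_closure_iff_nhds]
  intro t ht
  -- a basic neighbourhood `τ • Gal(F̄/E)`, `E/F` finite normal, inside `t`
  have ht1 : (fun g ↦ τ * g) ⁻¹' t ∈ nhds (1 : absoluteGaloisGroup F) := by
    refine (continuous_const_mul τ).continuousAt.preimage_mem_nhds ?_
    rwa [mul_one]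
  obtain ⟨E, hEfd, hEn, hEt⟩ :=
    (krullTopology_mem_nhds_one_iff_of_normal F (AlgebraicClosure F) _).mp ht1
  haveI := hEfd
  haveI := hEn
  -- the separable part `E ∩ F^{sep} = F(α)`: finite, separable, normal
  let Es : IntermediateField F (AlgebraicClosure F) := E ⊓ separableClosure F (AlgebraicClosure F)
  haveI : FiniteDimensional F Es := Module.Finite.of_injective
    (IntermediateField.inclusion (inf_le_left : Es ≤ E)).toLinearMap
    (IntermediateField.inclusion_injective (inf_le_left : Es ≤ E))
  haveI : Algebra.IsSeparable F Es :=
    (le_separableClosure_iff F (AlgebraicClosure F) _).mp inf_le_right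
  haveI : Normal F (separableClosure F (AlgebraicClosure F)) := inferInstance
  haveI : Normal F Es := inferInstance
  obtain ⟨α, hα⟩ := exists_eq_adjoin_simple_of_isSeparable Es
  have hEn' : Normal F F⟮α⟯ := hα ▸ (inferInstance : Normal F Es)
  obtain ⟨σ, hσI, hσ⟩ :=
    exists_mem_inertia_smul_apply_aeval_eq ι τ hiso hkey h𝔐 (exists_smul_eq_aeval_of_normal τ hEn')
  refine ⟨res σ, ?_, σ, hσI, rfl⟩
  -- `τ⁻¹ * res σ` fixes `F(α) = E ∩ F^{sep}`, hence `E`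
  have hfix' : absoluteGaloisGroup.toAlgEquiv F (τ⁻¹ * res σ) ∈ Es.fixingSubgroup := by
    rw [hα, IntermediateField.mem_fixingSubgroup_iff]
    intro x hx
    obtain ⟨p, rfl⟩ := (mem_adjoin_simple_iff_exists_aeval (Algebra.IsIntegral.isIntegral α)).mp hx
    change (τ⁻¹ * res σ) • aeval α p = aeval α p
    rw [mul_smul, inv_smul_eq_iff]
    apply ι.injective
    have h := apply_resGalAuxOfEmb_apply ι σ (aeval α p)
    rw [← resGalOfEmb_apply] at h
    exact h.trans (hσ p)
  have hfix : absoluteGaloisGroup.toAlgEquiv F (τ⁻¹ * res σ) ∈ E.fixingSubgroup :=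
    mem_fixingSubgroup_of_mem_fixingSubgroup_inf_separableClosure E hfix'
  have h : τ * (τ⁻¹ * res σ) ∈ t := hEt hfix
  rwa [mul_inv_cancel_left] at h

end Literature.NumberTheory.EllipticCurves.FunctionField

end
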